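import Literature.NumberTheory.GaloisRepresentations.WeilGroupProofs
import Literature.NumberTheory.GaloisRepresentations.LocalGaloisGroupInertiaProofs
import HarnessLib

/-!
# Discharge of `WeilGroup.continuous_map` (trunk GalRep, item C7)

D-0014 keeps `Literature/` sorry-free by stating cited results as named facts `def X : Prop`.
This sibling file of `Literature.NumberTheory.GaloisRepresentations.WeilGroup` proves the last
undischarged named fact of that file, `WeilGroup.continuous_map F E`: for a finite extension
`E/F` of non-archimedean local fields with compatible valuations, the functoriality map
`WeilGroup.map F E h : W_E →* W_F` (restriction `Gal(Ē/E) → Gal(F̄/F)` on the Weil groups) is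
continuous for the Weil topologies (Tate, *Number theoretic background*, Corvallis 1979,
(1.4.5)–(1.4.6): `W_E` is an open subgroup of finite index of `W_F`, topologised compatibly).

The Weil topology (`WeilGroup.instTopologicalSpace`) is generated by the basic sets
`B(w, V) = {x | x w⁻¹ ∈ I, x ∈ V}` (`w` in the Weil group, `V` Krull-open).  The proof is the
one-line argument of the printed source made explicit: the preimage of `B(w, V)` under
`map F E h` is Weil-open in `W_E`, because around any point `y₀` of the preimage it contains the
basic set `B(y₀, res⁻¹ V)` — `res = absGaloisRestrict F E` is continuous for the Krull
topologies (`AbsGaloisGroup.lean`), and `map F E h` sends `I_E` into `I_F`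
(`WeilGroup.map_inertia_le`, fed by the discharged fact
`absInertia_map_absGaloisRestrict_le_holds` of `LocalGaloisGroupInertiaProofs.lean`,
Serre, *Local Fields*, Ch. I §7, Prop. 22 a)), so that for `y ∈ B(y₀, res⁻¹ V)` one has
`map y · w⁻¹ = map (y y₀⁻¹) · (map y₀ · w⁻¹) ∈ I_F`.

Main result: `WeilGroup.continuous_map_holds F E : WeilGroup.continuous_map F E`
(the closed discharge; no hypothesis binders beyond the parameters of the fact).  The auxiliary
`WeilGroup.continuous_map_of_le` proves continuity of `map F E h` for ANY `F`-algebra `E`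
(no finiteness / compatibility needed once the inclusion `h : res (W_E) ≤ W_F` is given).

## References

* J. Tate, *Number theoretic background*, in: Automorphic forms, representations and
  `L`-functions (Corvallis 1977), Proc. Sympos. Pure Math. XXXIII, Part 2, AMS 1979,
  (1.4.1), (1.4.5)–(1.4.6).  [Tate1979] (= the interim key [Corvallis1979] of `WeilGroup.lean`)
* J.-P. Serre, *Local Fields*, GTM 67, Springer 1979, Ch. I §7, Prop. 22.  [SerreLocalFields1979]
-/

noncomputable section

open ValuativeRel Field Topology Set

namespace Literature.NumberTheory.GaloisRepresentations

namespace WeilGroup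

section AnyAlgebra

variable (F E : Type*) [Field F] [ValuativeRel F] [TopologicalSpace F]
  [IsNonarchimedeanLocalField F] [Field E] [ValuativeRel E] [TopologicalSpace E]
  [IsNonarchimedeanLocalField E] [Algebra F E]

/-- Continuity of `WeilGroup.map F E h : W_E →* W_F` for the Weil topologies, for any
`F`-algebra structure on the non-archimedean local field `E` and any witness `h` of
`res (W_E) ≤ W_F`: the preimage of a basic Weil-open set `B(w, V)` of `W_F` contains, around each
of its points `y₀`, the basic Weil-open set `B(y₀, res⁻¹ V)` of `W_E` (`res` is Krull-continuous
and `map` sends `I_E` into `I_F`, `map_inertia_le` with `absInertia_map_absGaloisRestrict_le_holds`).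
Ref: Tate, *Number theoretic background* (Corvallis 1979), (1.4.5)–(1.4.6); Serre, *Local Fields*,
Ch. I §7, Prop. 22 a).  [cite: Tate1979, (1.4.5)–(1.4.6)] -/
theorem continuous_map_of_le
    (h : (weilSubgroup E).map (absGaloisRestrict F E).toMonoidHom ≤ weilSubgroup F) :
    Continuous (map F E h) := by
  have hI : (inertia E).map (map F E h) ≤ inertia F :=
    map_inertia_le (absInertia_map_absGaloisRestrict_le_holds F E) h
  refine continuous_generateFrom_iff.mpr ?_
  rintro _ ⟨w, V, hV, rfl⟩
  rw [isOpen_iff_forall_mem_open]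
  intro y₀ hy₀
  simp only [mem_preimage, mem_setOf_eq, toAbsGalois_map] at hy₀
  obtain ⟨hI₀, hV₀⟩ := hy₀
  -- the Krull-open set `res⁻¹ V ⊆ Gal(Ē/E)`
  have hV' : IsOpen ((absGaloisRestrict F E) ⁻¹' V) := hV.preimage (absGaloisRestrict F E).continuous
  refine ⟨{y : WeilGroup E | y * y₀⁻¹ ∈ inertia E ∧ toAbsGalois E y ∈ (absGaloisRestrict F E) ⁻¹' V},
    ?_, isOpen_basicOpen y₀ hV', ?_⟩
  · rintro y ⟨hy, hyV⟩
    simp only [mem_preimage, mem_setOf_eq, toAbsGalois_map]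
    refine ⟨?_, hyV⟩
    have h1 : map F E h y * w⁻¹ = map F E h (y * y₀⁻¹) * (map F E h y₀ * w⁻¹) := by
      rw [map_mul, map_inv]
      group
    rw [h1]
    exact mul_mem (hI ⟨y * y₀⁻¹, hy, rfl⟩) hI₀
  · simp only [mem_setOf_eq, mul_inv_cancel, one_mem, true_and, mem_preimage]
    exact hV₀

end AnyAlgebra

section Holds

variable (F E : Type*) [Field F] [ValuativeRel F] [TopologicalSpace F]
  [IsNonarchimedeanLocalField F] [Field E] [ValuativeRel E] [TopologicalSpace E]
  [IsNonarchimedeanLocalField E] [Algebra F E] [FiniteDimensional F E] [ValuativeExtension F E]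

/-- **Discharge of `WeilGroup.continuous_map`**: for a finite extension `E/F` of non-archimedean
local fields with compatible valuations, `WeilGroup.map F E h : W_E → W_F` is continuous for the
Weil topologies, for every witness `h` of `res (W_E) ≤ W_F` (supplied by
`weilSubgroup_map_absGaloisRestrict_le_holds`).
Ref: Tate, *Number theoretic background* (Corvallis 1979), (1.4.5)–(1.4.6).
[cite: Tate1979, (1.4.5)–(1.4.6)] -/
theorem continuous_map_holds : continuous_map F E :=
  fun h => continuous_map_of_le F E h

end Holds

end WeilGroup

end Literature.NumberTheory.GaloisRepresentations

end
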